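import Summits.HodgeConjecture.HodgeConjecture.Theorems.SixfoldTableXOffResidue
import Literature.AlgebraicGeometry.HodgeTheory.CodimTwoDivisorPullbackGenerated
import HarnessLib

/-!
# TABLE X (dimension 6) — the census nodes are statements about ISOGENY CLASSES: their per-variety conclusions
# transport along isogenies, so one representative per isogeny class suffices (cell `pub-hodgeav-hg6`, req-37 (A) Q2b; eng-4 g2)

HONEST FRAMING. HC, `HC_AV` (stmt-1333), `HC_CM` (stmt-3052) and the rung H2 are NOT proved and do not occur here. The
census nodes `TableX.SixfoldCodimTwoCensus` (X2) / `TableX.SixfoldCodimThreeCensus` (X1) of `SixfoldTableXCover` are OURS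
(`@[conjecture]`), never asserted; below they occur only as CONCLUSIONS of theorems whose hypotheses are their own
isogeny-class forms. KERNEL ONLY: theorems over existing declarations; no definition, no `sorry`, no new named fact.

WHY THIS MODULE (audit axis A6, robustness, at the level of the CONCLUSION). The dossier behind X2 / X1
(`run/shared/lean/pub/pub-hodgeav-hg6/TABLE-X-g6-v0.md`, `-v1.md`) decides the exceptional Hodge classes ROW BY ROW, a
row being a Hodge-group / endomorphism type — an ISOGENY-CLASS datum —, whereas the nodes quantify over every complex
abelian sixfold `A` off the residue class. `SixfoldTableXClasses` (L7) shows the CLASS `dim A = 6 ∧ ¬ 𝒞 A` is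
isogeny-closed; this module shows the CONCLUSIONS are isogeny-invariant too, by van Geemen's «up to isogeny» argument
(LNM 1594, 3.6–3.7; Moonen–Zarhin 1999 (5.1)) exactly as the tree runs it for the fivefold predicate
`IsCodimTwoDivisorPullbackGenerated.of_isIsogeny`: along an isogeny `f : A ⟶ B` with quasi-inverse `g`
(`f ≫ g = [N]`), a rational `(p,p)`-class `c` on `A` is `N^{-2p} · f^*(g^* c)`; `f^*` maps divisor monomials to
divisor monomials, `(2,2)·(1,1)` cup products to such cup products (`cupProduct_map`), a pull-back `β^* w` along
`β : B.X ⟶ C.X` to the pull-back `(f ≫ β)^* w` along `A.X ⟶ C.X` (same `C`, `dim C < dim B = dim A`), and a pull-back of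
a Weil class of a Weil sixfold `(B', ψ, d)` to a pull-back of the SAME Weil class. Hence:

* §1 `codimTwoCensusAt_of_isIsogeny` / `…_iff_of_isIsogenous`: the X2-conclusion at `B` gives it at every `A ∼ B`.
* §2 `codimThreeCensusAt_of_isIsogeny` / `…_iff_of_isIsogenous`: the same for the four-summand X1-conclusion.
* §3 `sixfoldCodimTwoCensus_iff_forall_exists_isIsogenous`, `sixfoldCodimThreeCensus_iff_forall_exists_isIsogenous`:
  X2 (resp. X1) holds iff every off-residue sixfold is ISOGENOUS to some abelian variety satisfying the conclusion —
  the literal shape of the dossier's evidence (one model per row). So the auditors may read X2 / X1 row by row.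

Nothing here is a corollary of `HC_CM`; no hypothesis of the cover is discharged; typed ≠ proved.
-/

set_option linter.dupNamespace false

noncomputable section

open CategoryTheory
open Literature.AlgebraicGeometry Literature.AlgebraicGeometry.Motives
open Literature.AlgebraicGeometry.Motives.AbelianVariety (IsIsogenous IsIsogeny)
open Literature.AlgebraicGeometry.HodgeTheory
open Literature.AlgebraicGeometry.Milne1999
open Literature.AlgebraicTopology.SingularHomology
open Literature.Barriers.HodgeConjecture
open Summit.HodgeConjecture.HodgeConjecture.Ring2.ClassTargets
open Summit.HodgeConjecture.HodgeConjecture.Ring2.Motiv (ProdCMCell)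
open Summit.HodgeConjecture.HodgeConjecture.Ring2.Atlas (IsQuarticFieldTypeIVFourfold)

namespace Summit.HodgeConjecture.HodgeConjecture.TableX

/-- `f^*(β^* w) = (f ≫ β)^* w` for a homomorphism `f : A ⟶ B` of abelian varieties followed by an arbitrary morphism
`β : B.X ⟶ Z` of the underlying schemes (contravariant functoriality of Betti cohomology). [cite: HatcherAT2002, §3.1 (induced homomorphisms)] -/
theorem complexBetti_map_hom_map_apply {A B : AbelianVariety ℂ} {Z : SchemeOver ℂ} (f : A ⟶ B) (β : B.X ⟶ Z)
    (k : ℕ) (w : complexBetti Z k) :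
    complexBetti.map f.hom.hom.hom k (complexBetti.map β k w) = complexBetti.map (f.hom.hom.hom ≫ β) k w := by
  rw [complexBetti.map_comp, ModuleCat.comp_apply]

/-! ## §1 Codimension 2: the X2-conclusion transports along isogenies -/

/-- **The codimension-2 census conclusion descends along an isogeny `f : A ⟶ B`**: if every rational `(2,2)`-class
on `B` lies in `D²(B) ⊗ ℂ ⊔ span {β^* w : β : B.X ⟶ C.X, dim C < dim B, w rational (2,2) on C}`, then the same holds
on `A` (quasi-inverse `g`, `f ≫ g = [N]`: `c = N⁻⁴ f^* g^* c`; `f^*` preserves divisor spans and composes pull-backs;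
`dim A = dim B`). [cite: vanGeemen1994HodgeAV, 3.6–3.7] [cite: MoonenZarhin1999LowDim, §5 (5.1)]
[cite: MumfordAV1970, §19 Remark p. 169] -/
theorem codimTwoCensusAt_of_isIsogeny {A B : AbelianVariety ℂ} {f : A ⟶ B} (hf : IsIsogeny f)
    (hB : ∀ c : complexBetti B.X (2 * 2), IsRationalClass c → IsOfHodgeType B.dim B.X (2 * 2) 2 2 c →
      c ∈ divisorClassesSpan B.X B.dim 2 ⊔ Submodule.span ℂ {w' : complexBetti B.X (2 * 2) |
        ∃ (C : AbelianVariety ℂ) (g : B.X ⟶ C.X) (w : complexBetti C.X (2 * 2)), C.dim < B.dim ∧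
          IsRationalClass w ∧ IsOfHodgeType C.dim C.X (2 * 2) 2 2 w ∧ w' = complexBetti.map g (2 * 2) w}) :
    ∀ c : complexBetti A.X (2 * 2), IsRationalClass c → IsOfHodgeType A.dim A.X (2 * 2) 2 2 c →
      c ∈ divisorClassesSpan A.X A.dim 2 ⊔ Submodule.span ℂ {w' : complexBetti A.X (2 * 2) |
        ∃ (C : AbelianVariety ℂ) (g : A.X ⟶ C.X) (w : complexBetti C.X (2 * 2)), C.dim < A.dim ∧
          IsRationalClass w ∧ IsOfHodgeType C.dim C.X (2 * 2) 2 2 w ∧ w' = complexBetti.map g (2 * 2) w} := by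
  obtain ⟨g, N, hN, hfg, -⟩ := AbelianVariety.IsIsogeny.exists_nsmul_inverse_holds hf
  have hdim : A.dim = B.dim := AbelianVariety.dim_eq_of_isIsogeny hf
  intro c hcQ hcH
  have hc' := AbelianVariety.mapsTo_hodgeClasses g 2 ⟨hcQ, hcH⟩
  have hmem := hB _ hc'.1 hc'.2
  have hle : (divisorClassesSpan B.X B.dim 2 ⊔ Submodule.span ℂ {w' : complexBetti B.X (2 * 2) |
        ∃ (C : AbelianVariety ℂ) (g : B.X ⟶ C.X) (w : complexBetti C.X (2 * 2)), C.dim < B.dim ∧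
          IsRationalClass w ∧ IsOfHodgeType C.dim C.X (2 * 2) 2 2 w ∧
          w' = complexBetti.map g (2 * 2) w}).map (complexBetti.map f.hom.hom.hom (2 * 2)).hom ≤
      divisorClassesSpan A.X A.dim 2 ⊔ Submodule.span ℂ {w' : complexBetti A.X (2 * 2) |
        ∃ (C : AbelianVariety ℂ) (g : A.X ⟶ C.X) (w : complexBetti C.X (2 * 2)), C.dim < A.dim ∧
          IsRationalClass w ∧ IsOfHodgeType C.dim C.X (2 * 2) 2 2 w ∧
          w' = complexBetti.map g (2 * 2) w} := by
    rw [Submodule.map_sup]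
    refine sup_le_sup ?_ ?_
    · rintro _ ⟨y, hy, rfl⟩
      exact AbelianVariety.map_mem_divisorClassesSpan f hy
    · rw [Submodule.map_span, Submodule.span_le]
      rintro _ ⟨w', ⟨C, β, w, hC, hwQ, hwH, rfl⟩, rfl⟩
      exact Submodule.subset_span ⟨C, f.hom.hom.hom ≫ β, w, by omega, hwQ, hwH,
        complexBetti_map_hom_map_apply f β (2 * 2) w⟩
  have hN4 := hle ⟨_, hmem, rfl⟩
  change complexBetti.map f.hom.hom.hom (2 * 2) (complexBetti.map g.hom.hom.hom (2 * 2) c) ∈ _ at hN4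
  rw [complexBetti_map_map_of_comp_eq_nsmul_id hfg (2 * 2) c] at hN4
  have hN' : ((N : ℂ) ^ (2 * 2)) ≠ 0 := pow_ne_zero _ (Nat.cast_ne_zero.2 hN.ne')
  have := Submodule.smul_mem _ (((N : ℂ) ^ (2 * 2))⁻¹) hN4
  rwa [smul_smul, inv_mul_cancel₀ hN', one_smul] at this

/-- **The codimension-2 census conclusion is an isogeny invariant** (`A ∼ B`: to the source by the previous theorem,
to the target through a quasi-inverse). [cite: vanGeemen1994HodgeAV, Lemma 3.7] [cite: MumfordAV1970, §19 Remark p. 169] -/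
theorem codimTwoCensusAt_iff_of_isIsogenous {A B : AbelianVariety ℂ} (hAB : IsIsogenous A B) :
    (∀ c : complexBetti A.X (2 * 2), IsRationalClass c → IsOfHodgeType A.dim A.X (2 * 2) 2 2 c →
      c ∈ divisorClassesSpan A.X A.dim 2 ⊔ Submodule.span ℂ {w' : complexBetti A.X (2 * 2) |
        ∃ (C : AbelianVariety ℂ) (g : A.X ⟶ C.X) (w : complexBetti C.X (2 * 2)), C.dim < A.dim ∧
          IsRationalClass w ∧ IsOfHodgeType C.dim C.X (2 * 2) 2 2 w ∧ w' = complexBetti.map g (2 * 2) w}) ↔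
    (∀ c : complexBetti B.X (2 * 2), IsRationalClass c → IsOfHodgeType B.dim B.X (2 * 2) 2 2 c →
      c ∈ divisorClassesSpan B.X B.dim 2 ⊔ Submodule.span ℂ {w' : complexBetti B.X (2 * 2) |
        ∃ (C : AbelianVariety ℂ) (g : B.X ⟶ C.X) (w : complexBetti C.X (2 * 2)), C.dim < B.dim ∧
          IsRationalClass w ∧ IsOfHodgeType C.dim C.X (2 * 2) 2 2 w ∧ w' = complexBetti.map g (2 * 2) w}) := by
  obtain ⟨f', hf'⟩ := hAB.symm'
  obtain ⟨f, hf⟩ := hAB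
  exact ⟨fun hA ↦ codimTwoCensusAt_of_isIsogeny hf' hA, fun hB ↦ codimTwoCensusAt_of_isIsogeny hf hB⟩

/-! ## §2 Codimension 3: the X1-conclusion transports along isogenies -/

/-- **The codimension-3 census conclusion descends along an isogeny `f : A ⟶ B`**: the four summands — divisor
monomials, `(rational (2,2)) ∪ (rational (1,1))` cup products, pull-backs of rational `(3,3)`-classes from smaller
dimension, pull-backs of Weil classes of Weil-type SIXFOLDS `(B', ψ, d)` — are each mapped into the corresponding
summand at `A` by `f^*` (`cupProduct_map`; composition of pull-backs; the Weil datum `(B', ψ, d, w)` is unchanged), and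
`c = N⁻⁶ f^* g^* c`. [cite: vanGeemen1994HodgeAV, 3.6–3.7] [cite: MoonenZarhin1999LowDim, §5 (5.1)]
[cite: MumfordAV1970, §19 Remark p. 169] [cite: HatcherAT2002, Prop. 3.10 (naturality of cup product)] -/
theorem codimThreeCensusAt_of_isIsogeny {A B : AbelianVariety ℂ} {f : A ⟶ B} (hf : IsIsogeny f)
    (hB : ∀ c : complexBetti B.X (2 * 3), IsRationalClass c → IsOfHodgeType B.dim B.X (2 * 3) 3 3 c →
      c ∈ divisorClassesSpan B.X B.dim 3 ⊔ Submodule.span ℂ {w' : complexBetti B.X (2 * 3) |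
          ∃ (a : complexBetti B.X (2 * 2)) (b : complexBetti B.X (2 * 1)),
            IsRationalClass a ∧ IsOfHodgeType B.dim B.X (2 * 2) 2 2 a ∧ IsRationalClass b ∧
            IsOfHodgeType B.dim B.X (2 * 1) 1 1 b ∧ w' = cupProduct (two_mul_add_two_mul 2 1) a b} ⊔
        Submodule.span ℂ {w' : complexBetti B.X (2 * 3) |
          ∃ (C : AbelianVariety ℂ) (g : B.X ⟶ C.X) (w : complexBetti C.X (2 * 3)), C.dim < B.dim ∧
            IsRationalClass w ∧ IsOfHodgeType C.dim C.X (2 * 3) 3 3 w ∧ w' = complexBetti.map g (2 * 3) w} ⊔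
        Submodule.span ℂ {w' : complexBetti B.X (2 * 3) |
          ∃ (B' : AbelianVariety ℂ) (g : B.X ⟶ B'.X) (d : ℕ) (ψ : B' ⟶ B') (w : complexBetti B'.X (2 * 3)),
            B'.dim = 6 ∧ 0 < d ∧ ψ ≫ ψ = -(d • 𝟙 B') ∧ IsRationalClass w ∧
            IsOfHodgeType B'.dim B'.X (2 * 3) 3 3 w ∧ w ∈ weilClassesOf B' ψ 3 d ∧
            w' = complexBetti.map g (2 * 3) w}) :
    ∀ c : complexBetti A.X (2 * 3), IsRationalClass c → IsOfHodgeType A.dim A.X (2 * 3) 3 3 c →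
      c ∈ divisorClassesSpan A.X A.dim 3 ⊔ Submodule.span ℂ {w' : complexBetti A.X (2 * 3) |
          ∃ (a : complexBetti A.X (2 * 2)) (b : complexBetti A.X (2 * 1)),
            IsRationalClass a ∧ IsOfHodgeType A.dim A.X (2 * 2) 2 2 a ∧ IsRationalClass b ∧
            IsOfHodgeType A.dim A.X (2 * 1) 1 1 b ∧ w' = cupProduct (two_mul_add_two_mul 2 1) a b} ⊔
        Submodule.span ℂ {w' : complexBetti A.X (2 * 3) |
          ∃ (C : AbelianVariety ℂ) (g : A.X ⟶ C.X) (w : complexBetti C.X (2 * 3)), C.dim < A.dim ∧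
            IsRationalClass w ∧ IsOfHodgeType C.dim C.X (2 * 3) 3 3 w ∧ w' = complexBetti.map g (2 * 3) w} ⊔
        Submodule.span ℂ {w' : complexBetti A.X (2 * 3) |
          ∃ (B' : AbelianVariety ℂ) (g : A.X ⟶ B'.X) (d : ℕ) (ψ : B' ⟶ B') (w : complexBetti B'.X (2 * 3)),
            B'.dim = 6 ∧ 0 < d ∧ ψ ≫ ψ = -(d • 𝟙 B') ∧ IsRationalClass w ∧
            IsOfHodgeType B'.dim B'.X (2 * 3) 3 3 w ∧ w ∈ weilClassesOf B' ψ 3 d ∧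
            w' = complexBetti.map g (2 * 3) w} := by
  obtain ⟨g, N, hN, hfg, -⟩ := AbelianVariety.IsIsogeny.exists_nsmul_inverse_holds hf
  have hdim : A.dim = B.dim := AbelianVariety.dim_eq_of_isIsogeny hf
  intro c hcQ hcH
  have hc' := AbelianVariety.mapsTo_hodgeClasses g 3 ⟨hcQ, hcH⟩
  have hmem := hB _ hc'.1 hc'.2
  -- `f^*` maps each of the four summands at `B` into the corresponding summand at `A`
  have hle : (divisorClassesSpan B.X B.dim 3 ⊔ Submodule.span ℂ {w' : complexBetti B.X (2 * 3) |
          ∃ (a : complexBetti B.X (2 * 2)) (b : complexBetti B.X (2 * 1)),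
            IsRationalClass a ∧ IsOfHodgeType B.dim B.X (2 * 2) 2 2 a ∧ IsRationalClass b ∧
            IsOfHodgeType B.dim B.X (2 * 1) 1 1 b ∧ w' = cupProduct (two_mul_add_two_mul 2 1) a b} ⊔
        Submodule.span ℂ {w' : complexBetti B.X (2 * 3) |
          ∃ (C : AbelianVariety ℂ) (g : B.X ⟶ C.X) (w : complexBetti C.X (2 * 3)), C.dim < B.dim ∧
            IsRationalClass w ∧ IsOfHodgeType C.dim C.X (2 * 3) 3 3 w ∧ w' = complexBetti.map g (2 * 3) w} ⊔
        Submodule.span ℂ {w' : complexBetti B.X (2 * 3) |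
          ∃ (B' : AbelianVariety ℂ) (g : B.X ⟶ B'.X) (d : ℕ) (ψ : B' ⟶ B') (w : complexBetti B'.X (2 * 3)),
            B'.dim = 6 ∧ 0 < d ∧ ψ ≫ ψ = -(d • 𝟙 B') ∧ IsRationalClass w ∧
            IsOfHodgeType B'.dim B'.X (2 * 3) 3 3 w ∧ w ∈ weilClassesOf B' ψ 3 d ∧
            w' = complexBetti.map g (2 * 3) w}).map (complexBetti.map f.hom.hom.hom (2 * 3)).hom ≤
      divisorClassesSpan A.X A.dim 3 ⊔ Submodule.span ℂ {w' : complexBetti A.X (2 * 3) |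
          ∃ (a : complexBetti A.X (2 * 2)) (b : complexBetti A.X (2 * 1)),
            IsRationalClass a ∧ IsOfHodgeType A.dim A.X (2 * 2) 2 2 a ∧ IsRationalClass b ∧
            IsOfHodgeType A.dim A.X (2 * 1) 1 1 b ∧ w' = cupProduct (two_mul_add_two_mul 2 1) a b} ⊔
        Submodule.span ℂ {w' : complexBetti A.X (2 * 3) |
          ∃ (C : AbelianVariety ℂ) (g : A.X ⟶ C.X) (w : complexBetti C.X (2 * 3)), C.dim < A.dim ∧
            IsRationalClass w ∧ IsOfHodgeType C.dim C.X (2 * 3) 3 3 w ∧ w' = complexBetti.map g (2 * 3) w} ⊔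
        Submodule.span ℂ {w' : complexBetti A.X (2 * 3) |
          ∃ (B' : AbelianVariety ℂ) (g : A.X ⟶ B'.X) (d : ℕ) (ψ : B' ⟶ B') (w : complexBetti B'.X (2 * 3)),
            B'.dim = 6 ∧ 0 < d ∧ ψ ≫ ψ = -(d • 𝟙 B') ∧ IsRationalClass w ∧
            IsOfHodgeType B'.dim B'.X (2 * 3) 3 3 w ∧ w ∈ weilClassesOf B' ψ 3 d ∧
            w' = complexBetti.map g (2 * 3) w} := by
    rw [Submodule.map_sup, Submodule.map_sup, Submodule.map_sup]
    refine sup_le_sup (sup_le_sup (sup_le_sup ?_ ?_) ?_) ?_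
    · rintro _ ⟨y, hy, rfl⟩
      exact AbelianVariety.map_mem_divisorClassesSpan f hy
    · rw [Submodule.map_span, Submodule.span_le]
      rintro _ ⟨w', ⟨a, b, haQ, haH, hbQ, hbH, rfl⟩, rfl⟩
      have ha := AbelianVariety.mapsTo_hodgeClasses f 2 ⟨haQ, haH⟩
      have hb := AbelianVariety.mapsTo_hodgeClasses f 1 ⟨hbQ, hbH⟩
      exact Submodule.subset_span ⟨_, _, ha.1, ha.2, hb.1, hb.2, cupProduct_map _ _ a b⟩
    · rw [Submodule.map_span, Submodule.span_le]
      rintro _ ⟨w', ⟨C, β, w, hC, hwQ, hwH, rfl⟩, rfl⟩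
      exact Submodule.subset_span ⟨C, f.hom.hom.hom ≫ β, w, by omega, hwQ, hwH,
        complexBetti_map_hom_map_apply f β (2 * 3) w⟩
    · rw [Submodule.map_span, Submodule.span_le]
      rintro _ ⟨w', ⟨B', β, d, ψ, w, hB', hd, hψ, hwQ, hwH, hweil, rfl⟩, rfl⟩
      exact Submodule.subset_span ⟨B', f.hom.hom.hom ≫ β, d, ψ, w, hB', hd, hψ, hwQ, hwH, hweil,
        complexBetti_map_hom_map_apply f β (2 * 3) w⟩
  have hN6 := hle ⟨_, hmem, rfl⟩
  change complexBetti.map f.hom.hom.hom (2 * 3) (complexBetti.map g.hom.hom.hom (2 * 3) c) ∈ _ at hN6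
  rw [complexBetti_map_map_of_comp_eq_nsmul_id hfg (2 * 3) c] at hN6
  have hN' : ((N : ℂ) ^ (2 * 3)) ≠ 0 := pow_ne_zero _ (Nat.cast_ne_zero.2 hN.ne')
  have := Submodule.smul_mem _ (((N : ℂ) ^ (2 * 3))⁻¹) hN6
  rwa [smul_smul, inv_mul_cancel₀ hN', one_smul] at this

/-- **The codimension-3 census conclusion is an isogeny invariant.** [cite: vanGeemen1994HodgeAV, Lemma 3.7]
[cite: MumfordAV1970, §19 Remark p. 169] -/
theorem codimThreeCensusAt_iff_of_isIsogenous {A B : AbelianVariety ℂ} (hAB : IsIsogenous A B) :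
    (∀ c : complexBetti A.X (2 * 3), IsRationalClass c → IsOfHodgeType A.dim A.X (2 * 3) 3 3 c →
      c ∈ divisorClassesSpan A.X A.dim 3 ⊔ Submodule.span ℂ {w' : complexBetti A.X (2 * 3) |
          ∃ (a : complexBetti A.X (2 * 2)) (b : complexBetti A.X (2 * 1)),
            IsRationalClass a ∧ IsOfHodgeType A.dim A.X (2 * 2) 2 2 a ∧ IsRationalClass b ∧
            IsOfHodgeType A.dim A.X (2 * 1) 1 1 b ∧ w' = cupProduct (two_mul_add_two_mul 2 1) a b} ⊔
        Submodule.span ℂ {w' : complexBetti A.X (2 * 3) |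
          ∃ (C : AbelianVariety ℂ) (g : A.X ⟶ C.X) (w : complexBetti C.X (2 * 3)), C.dim < A.dim ∧
            IsRationalClass w ∧ IsOfHodgeType C.dim C.X (2 * 3) 3 3 w ∧ w' = complexBetti.map g (2 * 3) w} ⊔
        Submodule.span ℂ {w' : complexBetti A.X (2 * 3) |
          ∃ (B' : AbelianVariety ℂ) (g : A.X ⟶ B'.X) (d : ℕ) (ψ : B' ⟶ B') (w : complexBetti B'.X (2 * 3)),
            B'.dim = 6 ∧ 0 < d ∧ ψ ≫ ψ = -(d • 𝟙 B') ∧ IsRationalClass w ∧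
            IsOfHodgeType B'.dim B'.X (2 * 3) 3 3 w ∧ w ∈ weilClassesOf B' ψ 3 d ∧
            w' = complexBetti.map g (2 * 3) w}) ↔
    (∀ c : complexBetti B.X (2 * 3), IsRationalClass c → IsOfHodgeType B.dim B.X (2 * 3) 3 3 c →
      c ∈ divisorClassesSpan B.X B.dim 3 ⊔ Submodule.span ℂ {w' : complexBetti B.X (2 * 3) |
          ∃ (a : complexBetti B.X (2 * 2)) (b : complexBetti B.X (2 * 1)),
            IsRationalClass a ∧ IsOfHodgeType B.dim B.X (2 * 2) 2 2 a ∧ IsRationalClass b ∧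
            IsOfHodgeType B.dim B.X (2 * 1) 1 1 b ∧ w' = cupProduct (two_mul_add_two_mul 2 1) a b} ⊔
        Submodule.span ℂ {w' : complexBetti B.X (2 * 3) |
          ∃ (C : AbelianVariety ℂ) (g : B.X ⟶ C.X) (w : complexBetti C.X (2 * 3)), C.dim < B.dim ∧
            IsRationalClass w ∧ IsOfHodgeType C.dim C.X (2 * 3) 3 3 w ∧ w' = complexBetti.map g (2 * 3) w} ⊔
        Submodule.span ℂ {w' : complexBetti B.X (2 * 3) |
          ∃ (B' : AbelianVariety ℂ) (g : B.X ⟶ B'.X) (d : ℕ) (ψ : B' ⟶ B') (w : complexBetti B'.X (2 * 3)),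
            B'.dim = 6 ∧ 0 < d ∧ ψ ≫ ψ = -(d • 𝟙 B') ∧ IsRationalClass w ∧
            IsOfHodgeType B'.dim B'.X (2 * 3) 3 3 w ∧ w ∈ weilClassesOf B' ψ 3 d ∧
            w' = complexBetti.map g (2 * 3) w}) := by
  obtain ⟨f', hf'⟩ := hAB.symm'
  obtain ⟨f, hf⟩ := hAB
  exact ⟨fun hA ↦ codimThreeCensusAt_of_isIsogeny hf' hA, fun hB ↦ codimThreeCensusAt_of_isIsogeny hf hB⟩

/-! ## §3 The census nodes, isogeny class by isogeny class -/

/-- **X2 ROW BY ROW.** The codimension-2 census node `SixfoldCodimTwoCensus` holds iff every complex abelian sixfold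
off the residue class is ISOGENOUS to some abelian variety on which the codimension-2 conclusion holds — one model
per isogeny class suffices, which is how the dossier (TABLE X, one row per Hodge-group type) decides it. Neither side
is asserted. [cite: vanGeemen1994HodgeAV, 3.6–3.7] [cite: MoonenZarhin1999LowDim, Thm. 0.1 and §5 (5.1)] -/
theorem sixfoldCodimTwoCensus_iff_forall_exists_isIsogenous :
    SixfoldCodimTwoCensus ↔
      ∀ A : AbelianVariety ℂ, A.dim = 6 →
        ¬ (IsOfCMType A ∨ ProdCMCell IsQuarticFieldTypeIVFourfold (fun Z ↦ Z.dim = 2) A) →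
        ∃ B : AbelianVariety ℂ, IsIsogenous A B ∧
          ∀ c : complexBetti B.X (2 * 2), IsRationalClass c → IsOfHodgeType B.dim B.X (2 * 2) 2 2 c →
            c ∈ divisorClassesSpan B.X B.dim 2 ⊔ Submodule.span ℂ {w' : complexBetti B.X (2 * 2) |
              ∃ (C : AbelianVariety ℂ) (g : B.X ⟶ C.X) (w : complexBetti C.X (2 * 2)), C.dim < B.dim ∧
                IsRationalClass w ∧ IsOfHodgeType C.dim C.X (2 * 2) 2 2 w ∧
                w' = complexBetti.map g (2 * 2) w} := by
  refine ⟨fun h A h6 hA ↦ ⟨A, AbelianVariety.IsIsogenous.refl A, h A h6 hA⟩, fun h A h6 hA ↦ ?_⟩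
  obtain ⟨B, hAB, hB⟩ := h A h6 hA
  exact (codimTwoCensusAt_iff_of_isIsogenous hAB).mpr hB

/-- **X1 ROW BY ROW.** The codimension-3 census node `SixfoldCodimThreeCensus` holds iff every complex abelian sixfold
off the residue class is isogenous to some abelian variety on which the codimension-3 conclusion holds. Neither side
is asserted. [cite: vanGeemen1994HodgeAV, 3.6–3.7] [cite: MoonenZarhin1999LowDim, Thm. 0.2 and §5 (5.1)] -/
theorem sixfoldCodimThreeCensus_iff_forall_exists_isIsogenous :
    SixfoldCodimThreeCensus ↔
      ∀ A : AbelianVariety ℂ, A.dim = 6 →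
        ¬ (IsOfCMType A ∨ ProdCMCell IsQuarticFieldTypeIVFourfold (fun Z ↦ Z.dim = 2) A) →
        ∃ B : AbelianVariety ℂ, IsIsogenous A B ∧
          ∀ c : complexBetti B.X (2 * 3), IsRationalClass c → IsOfHodgeType B.dim B.X (2 * 3) 3 3 c →
            c ∈ divisorClassesSpan B.X B.dim 3 ⊔ Submodule.span ℂ {w' : complexBetti B.X (2 * 3) |
                ∃ (a : complexBetti B.X (2 * 2)) (b : complexBetti B.X (2 * 1)),
                  IsRationalClass a ∧ IsOfHodgeType B.dim B.X (2 * 2) 2 2 a ∧ IsRationalClass b ∧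
                  IsOfHodgeType B.dim B.X (2 * 1) 1 1 b ∧ w' = cupProduct (two_mul_add_two_mul 2 1) a b} ⊔
              Submodule.span ℂ {w' : complexBetti B.X (2 * 3) |
                ∃ (C : AbelianVariety ℂ) (g : B.X ⟶ C.X) (w : complexBetti C.X (2 * 3)), C.dim < B.dim ∧
                  IsRationalClass w ∧ IsOfHodgeType C.dim C.X (2 * 3) 3 3 w ∧
                  w' = complexBetti.map g (2 * 3) w} ⊔
              Submodule.span ℂ {w' : complexBetti B.X (2 * 3) |
                ∃ (B' : AbelianVariety ℂ) (g : B.X ⟶ B'.X) (d : ℕ) (ψ : B' ⟶ B') (w : complexBetti B'.X (2 * 3)),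
                  B'.dim = 6 ∧ 0 < d ∧ ψ ≫ ψ = -(d • 𝟙 B') ∧ IsRationalClass w ∧
                  IsOfHodgeType B'.dim B'.X (2 * 3) 3 3 w ∧ w ∈ weilClassesOf B' ψ 3 d ∧
                  w' = complexBetti.map g (2 * 3) w} := by
  refine ⟨fun h A h6 hA ↦ ⟨A, AbelianVariety.IsIsogenous.refl A, h A h6 hA⟩, fun h A h6 hA ↦ ?_⟩
  obtain ⟨B, hAB, hB⟩ := h A h6 hA
  exact (codimThreeCensusAt_iff_of_isIsogenous hAB).mpr hB

/-- **The two census nodes together, isogeny class by isogeny class**: X2 ∧ X1 iff every off-residue sixfold has an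
isogenous model satisfying BOTH conclusions (the common model may be taken to be the variety itself).
[cite: vanGeemen1994HodgeAV, 3.6–3.7] [cite: MoonenZarhin1999LowDim, Thms. 0.1–0.2, §5 (5.1)] -/
theorem sixfoldCensus_iff_forall_exists_isIsogenous :
    (SixfoldCodimTwoCensus ∧ SixfoldCodimThreeCensus) ↔
      ∀ A : AbelianVariety ℂ, A.dim = 6 →
        ¬ (IsOfCMType A ∨ ProdCMCell IsQuarticFieldTypeIVFourfold (fun Z ↦ Z.dim = 2) A) →
        ∃ B : AbelianVariety ℂ, IsIsogenous A B ∧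
          (∀ c : complexBetti B.X (2 * 2), IsRationalClass c → IsOfHodgeType B.dim B.X (2 * 2) 2 2 c →
            c ∈ divisorClassesSpan B.X B.dim 2 ⊔ Submodule.span ℂ {w' : complexBetti B.X (2 * 2) |
              ∃ (C : AbelianVariety ℂ) (g : B.X ⟶ C.X) (w : complexBetti C.X (2 * 2)), C.dim < B.dim ∧
                IsRationalClass w ∧ IsOfHodgeType C.dim C.X (2 * 2) 2 2 w ∧
                w' = complexBetti.map g (2 * 2) w}) ∧
          (∀ c : complexBetti B.X (2 * 3), IsRationalClass c → IsOfHodgeType B.dim B.X (2 * 3) 3 3 c →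
            c ∈ divisorClassesSpan B.X B.dim 3 ⊔ Submodule.span ℂ {w' : complexBetti B.X (2 * 3) |
                ∃ (a : complexBetti B.X (2 * 2)) (b : complexBetti B.X (2 * 1)),
                  IsRationalClass a ∧ IsOfHodgeType B.dim B.X (2 * 2) 2 2 a ∧ IsRationalClass b ∧
                  IsOfHodgeType B.dim B.X (2 * 1) 1 1 b ∧ w' = cupProduct (two_mul_add_two_mul 2 1) a b} ⊔
              Submodule.span ℂ {w' : complexBetti B.X (2 * 3) |
                ∃ (C : AbelianVariety ℂ) (g : B.X ⟶ C.X) (w : complexBetti C.X (2 * 3)), C.dim < B.dim ∧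
                  IsRationalClass w ∧ IsOfHodgeType C.dim C.X (2 * 3) 3 3 w ∧
                  w' = complexBetti.map g (2 * 3) w} ⊔
              Submodule.span ℂ {w' : complexBetti B.X (2 * 3) |
                ∃ (B' : AbelianVariety ℂ) (g : B.X ⟶ B'.X) (d : ℕ) (ψ : B' ⟶ B') (w : complexBetti B'.X (2 * 3)),
                  B'.dim = 6 ∧ 0 < d ∧ ψ ≫ ψ = -(d • 𝟙 B') ∧ IsRationalClass w ∧
                  IsOfHodgeType B'.dim B'.X (2 * 3) 3 3 w ∧ w ∈ weilClassesOf B' ψ 3 d ∧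
                  w' = complexBetti.map g (2 * 3) w}) := by
  refine ⟨fun h A h6 hA ↦ ⟨A, AbelianVariety.IsIsogenous.refl A, h.1 A h6 hA, h.2 A h6 hA⟩, fun h ↦ ⟨?_, ?_⟩⟩
  · intro A h6 hA
    obtain ⟨B, hAB, hB, -⟩ := h A h6 hA
    exact (codimTwoCensusAt_iff_of_isIsogenous hAB).mpr hB
  · intro A h6 hA
    obtain ⟨B, hAB, -, hB⟩ := h A h6 hA
    exact (codimThreeCensusAt_iff_of_isIsogenous hAB).mpr hB

end Summit.HodgeConjecture.HodgeConjecture.TableX
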